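import Mathlib.Analysis.ODE.Gronwall
import Mathlib.Analysis.Calculus.ContDiff.Deriv
import Mathlib.Analysis.Normed.Ring.Lemmas
import Literature.NumberTheory.LFunctions.ConnesProlateGuess
import HarnessLib

/-!
# Prolate functions are even: the parity of `h_{n,λ}` from the differential equation

The prolate functions `h_{n,λ}` of Connes' Letter (2026, §6.3–6.4) are, on `(−λ, λ)`, eigenfunctions of the
prolate differential operator `(W_λ ψ)(x) = −∂_x((λ² − x²)∂_x ψ(x)) + (2πλx)² ψ(x)`, of class `C²` on
`[−λ, λ]`, with `h_{n,λ}(0) > 0` (this is how `IsProlateFunction` axiomatises them).  We prove that every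
such function is EVEN — the classical parity property of the prolate spheroidal wave functions
(Slepian–Pollak 1961, §III: `ψ_n(−x) = (−1)^n ψ_n(x)`; the Letter uses even `n`) —
by the Sturm–Liouville argument, with no special-function input:

* the coefficients of `W_λ` are even, so `x ↦ f(−x)` solves the same equation (`hasDerivAt_comp_neg`,
  `ode`);
* the weighted Wronskian `(λ² − x²)(f(x)g′(x) − f′(x)g(x))` of two solutions is constant on `(−λ, λ)`
  (Lagrange's identity) and tends to `0` at the singular end point `x → λ⁻` because `f, f′` are bounded on
  `[−λ, λ]`; hence it vanishes, and at `x = 0` this gives `f′(0) = 0` (`deriv_zero`, using `f(0) > 0`);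
* `f` and `x ↦ f(−x)` then solve the same regular linear ODE on every `[−μ, μ]`, `μ < λ`, with the same
  Cauchy data at `0`, so they coincide by uniqueness (Mathlib's `ODE_solution_unique_of_mem_Ioo`, applied
  to the phase vector `(f, f′)`); at `x = ±λ` by continuity on `[−λ, λ]`, and beyond by the support
  condition (`IsProlateFunction.even`).

Consequently the evenness hypotheses in the analysis of the Letter's Fact 6.4
(`ConnesProlateGuessTail.lean`, `ConnesProlateGuessError.lean`) are automatic.  Nothing here is specific
to `ζ`, and nothing approaches RH.
-/

open Real Set Filter Topology

namespace Literature.NumberTheory.LFunctions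

namespace IsProlateFunction

variable {lam : ℝ} {n : ℕ} {f : ℝ → ℝ}

/-- `h_{n,λ}` is `C²` on the open interval. [cite: Connes2026Letter, §6.3] -/
theorem contDiffOn_Ioo (hf : IsProlateFunction lam n f) : ContDiffOn ℝ 2 f (Ioo (-lam) lam) :=
  hf.contDiffOn.mono Ioo_subset_Icc_self

/-- `h_{n,λ}` is differentiable on `(−λ, λ)`. [cite: Connes2026Letter, §6.3] -/
theorem differentiableAt (hf : IsProlateFunction lam n f) {x : ℝ} (hx : x ∈ Ioo (-lam) lam) :
    DifferentiableAt ℝ f x :=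
  (hf.contDiffOn_Ioo.differentiableOn (by norm_num)).differentiableAt (isOpen_Ioo.mem_nhds hx)

/-- `h_{n,λ}′` is `C¹` on `(−λ, λ)`. [cite: Connes2026Letter, §6.3] -/
theorem contDiffOn_deriv_Ioo (hf : IsProlateFunction lam n f) :
    ContDiffOn ℝ 1 (deriv f) (Ioo (-lam) lam) := by
  have h := hf.contDiffOn_Ioo
  rw [← one_add_one_eq_two] at h
  exact ((contDiffOn_succ_iff_deriv_of_isOpen isOpen_Ioo).1 h).2.2

/-- `h_{n,λ}′` is differentiable on `(−λ, λ)`. [cite: Connes2026Letter, §6.3] -/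
theorem differentiableAt_deriv (hf : IsProlateFunction lam n f) {x : ℝ} (hx : x ∈ Ioo (-lam) lam) :
    DifferentiableAt ℝ (deriv f) x :=
  (hf.contDiffOn_deriv_Ioo.differentiableOn one_ne_zero).differentiableAt (isOpen_Ioo.mem_nhds hx)

/-- The prolate equation solved for the second derivative:
`(λ² − x²) f″(x) = 2x f′(x) + ((2πλx)² − χ) f(x)` on `(−λ, λ)`. [cite: Connes2026Letter, §6.3] -/
theorem ode (hf : IsProlateFunction lam n f) : ∃ χ : ℝ, ∀ x ∈ Ioo (-lam) lam,
    (lam ^ 2 - x ^ 2) * deriv (deriv f) x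
      = 2 * x * deriv f x + ((2 * π * lam * x) ^ 2 - χ) * f x := by
  obtain ⟨χ, hχ⟩ := hf.eigen
  refine ⟨χ, fun x hx ↦ ?_⟩
  have hp : HasDerivAt (fun y : ℝ ↦ lam ^ 2 - y ^ 2) (-(2 * x)) x := by
    simpa using (hasDerivAt_pow 2 x).const_sub (lam ^ 2)
  have hd : HasDerivAt (deriv f) (deriv (deriv f) x) x := (hf.differentiableAt_deriv hx).hasDerivAt
  have e' : deriv (fun y ↦ (lam ^ 2 - y ^ 2) * deriv f y) x
      = -(2 * x) * deriv f x + (lam ^ 2 - x ^ 2) * deriv (deriv f) x := (hp.mul hd).deriv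
  have e := hχ x hx
  rw [e'] at e
  linear_combination -e

/-- The reflected function `x ↦ f(−x)` and its derivative `−f′(−x)` on `(−λ, λ)`.
[cite: Connes2026Letter, §6.3] -/
theorem hasDerivAt_comp_neg (hf : IsProlateFunction lam n f) {x : ℝ} (hx : x ∈ Ioo (-lam) lam) :
    HasDerivAt (fun y ↦ f (-y)) (-deriv f (-x)) x := by
  have hnx : -x ∈ Ioo (-lam) lam := ⟨by linarith [hx.2], by linarith [hx.1]⟩
  have h := ((hf.differentiableAt hnx).hasDerivAt).scomp x (hasDerivAt_neg x)
  simpa [Function.comp_def] using h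

/-- The derivative of `x ↦ −f′(−x)` is `f″(−x)` on `(−λ, λ)`. [cite: Connes2026Letter, §6.3] -/
theorem hasDerivAt_neg_deriv_comp_neg (hf : IsProlateFunction lam n f) {x : ℝ}
    (hx : x ∈ Ioo (-lam) lam) :
    HasDerivAt (fun y ↦ -deriv f (-y)) (deriv (deriv f) (-x)) x := by
  have hnx : -x ∈ Ioo (-lam) lam := ⟨by linarith [hx.2], by linarith [hx.1]⟩
  have h := (((hf.differentiableAt_deriv hnx).hasDerivAt).scomp x (hasDerivAt_neg x)).neg
  simpa [Function.comp_def, Pi.neg_def] using h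

/-- `f` and `f′` are bounded on `(−λ, λ)` (they extend continuously to `[−λ, λ]`).
[cite: Connes2026Letter, §6.3] -/
theorem exists_bound_deriv (hf : IsProlateFunction lam n f) :
    ∃ B : ℝ, ∀ x ∈ Ioo (-lam) lam, |f x| ≤ B ∧ |deriv f x| ≤ B := by
  have hlam := hf.lam_pos
  obtain ⟨B₁, hB₁⟩ := isCompact_Icc.exists_bound_of_continuousOn hf.contDiffOn.continuousOn
  have hcd : ContinuousOn (derivWithin f (Icc (-lam) lam)) (Icc (-lam) lam) :=
    hf.contDiffOn.continuousOn_derivWithin (uniqueDiffOn_Icc (by linarith)) (by norm_num)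
  obtain ⟨B₂, hB₂⟩ := isCompact_Icc.exists_bound_of_continuousOn hcd
  refine ⟨max B₁ B₂, fun x hx ↦ ⟨?_, ?_⟩⟩
  · have := hB₁ x (Ioo_subset_Icc_self hx)
    rw [Real.norm_eq_abs] at this
    exact this.trans (le_max_left _ _)
  · have := hB₂ x (Ioo_subset_Icc_self hx)
    rw [Real.norm_eq_abs, derivWithin_of_mem_nhds (Icc_mem_nhds hx.1 hx.2)] at this
    exact this.trans (le_max_right _ _)

/-- `h_{n,λ}′(0) = 0`: the weighted Wronskian `(λ² − x²)(f(x)·(−f′(−x)) − f′(x)f(−x))` of the two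
solutions `f`, `f(−·)` is constant (Lagrange's identity) and tends to `0` at the singular end point `λ`,
so it vanishes; at `x = 0` it equals `−2λ²f(0)f′(0)` and `f(0) > 0`.
[cite: SlepianPollak1961, §III; Connes2026Letter, §6.3] -/
theorem deriv_zero (hf : IsProlateFunction lam n f) : deriv f 0 = 0 := by
  have hlam := hf.lam_pos
  obtain ⟨χ, hode⟩ := hf.ode
  -- the weighted Wronskian
  let W : ℝ → ℝ := fun t ↦
    (lam ^ 2 - t ^ 2) * (f t * (-deriv f (-t)) - deriv f t * f (-t))
  have hW : ∀ t ∈ Ioo (-lam) lam, HasDerivAt W 0 t := by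
    intro t ht
    have hnt : -t ∈ Ioo (-lam) lam := ⟨by linarith [ht.2], by linarith [ht.1]⟩
    have hp : HasDerivAt (fun y : ℝ ↦ lam ^ 2 - y ^ 2) (-(2 * t)) t := by
      simpa using (hasDerivAt_pow 2 t).const_sub (lam ^ 2)
    have h1 : HasDerivAt f (deriv f t) t := (hf.differentiableAt ht).hasDerivAt
    have h2 : HasDerivAt (deriv f) (deriv (deriv f) t) t :=
      (hf.differentiableAt_deriv ht).hasDerivAt
    have h3 := hf.hasDerivAt_comp_neg ht
    have h4 := hf.hasDerivAt_neg_deriv_comp_neg ht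
    have h := hp.mul ((h1.mul h4).sub (h2.mul h3))
    refine h.congr_deriv ?_
    have e1 := hode t ht
    have e2 := hode (-t) hnt
    simp only [Pi.mul_apply, Pi.sub_apply]
    linear_combination f t * e2 - f (-t) * e1
  have hWdiff : DifferentiableOn ℝ W (Ioo (-lam) lam) :=
    fun t ht ↦ (hW t ht).differentiableAt.differentiableWithinAt
  have h0 : (0 : ℝ) ∈ Ioo (-lam) lam := ⟨by linarith, hlam⟩
  have hconst : ∀ t ∈ Ioo (-lam) lam, W t = W 0 := fun t ht ↦
    isOpen_Ioo.is_const_of_deriv_eq_zero (convex_Ioo _ _).isPreconnected hWdiff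
      (fun s hs ↦ (hW s hs).deriv) ht h0
  -- the Wronskian tends to `0` at `λ⁻`
  obtain ⟨B, hB⟩ := hf.exists_bound_deriv
  have hmem : Ioo (-lam) lam ∈ 𝓝[<] lam := Ioo_mem_nhdsLT (by linarith)
  have hlim0 : Tendsto W (𝓝[<] lam) (𝓝 0) := by
    have hp : Tendsto (fun t : ℝ ↦ lam ^ 2 - t ^ 2) (𝓝[<] lam) (𝓝 0) := by
      have hc : Continuous (fun t : ℝ ↦ lam ^ 2 - t ^ 2) := by fun_prop
      have := (hc.tendsto lam).mono_left (nhdsWithin_le_nhds (s := Iio lam))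
      simpa using this
    refine hp.zero_mul_isBoundedUnder_le ⟨B * B + B * B, ?_⟩
    rw [eventually_map]
    filter_upwards [hmem] with t ht
    have hnt : -t ∈ Ioo (-lam) lam := ⟨by linarith [ht.2], by linarith [ht.1]⟩
    have hB0 : 0 ≤ B := (abs_nonneg _).trans (hB t ht).1
    simp only [Function.comp_apply, Real.norm_eq_abs]
    calc |f t * -deriv f (-t) - deriv f t * f (-t)|
        ≤ |f t * -deriv f (-t)| + |deriv f t * f (-t)| := abs_sub _ _
      _ ≤ B * B + B * B := by
          rw [abs_mul, abs_mul, abs_neg]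
          exact add_le_add (mul_le_mul (hB t ht).1 (hB _ hnt).2 (abs_nonneg _) hB0)
            (mul_le_mul (hB t ht).2 (hB _ hnt).1 (abs_nonneg _) hB0)
  have hlimC : Tendsto W (𝓝[<] lam) (𝓝 (W 0)) :=
    tendsto_const_nhds.congr' (by filter_upwards [hmem] with t ht using (hconst t ht).symm)
  have hW0 : W 0 = 0 := tendsto_nhds_unique hlimC hlim0
  have h : lam ^ 2 * (2 * f 0) * deriv f 0 = 0 := by
    simp only [W, neg_zero] at hW0
    linear_combination -hW0
  rcases mul_eq_zero.mp h with h | h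
  · exfalso
    have : 0 < lam ^ 2 * (2 * f 0) := by have := hf.pos_zero; positivity
    exact this.ne' h
  · exact h

/-- `f(−x) = f(x)` on `(−λ, λ)`: uniqueness for the regular Cauchy problem at `0` on `[−μ, μ]`, `μ < λ`.
[cite: SlepianPollak1961, §III; Connes2026Letter, §6.3] -/
theorem even_of_mem_Ioo (hf : IsProlateFunction lam n f) {x : ℝ} (hx : x ∈ Ioo (-lam) lam) :
    f (-x) = f x := by
  have hlam := hf.lam_pos
  obtain ⟨χ, hode⟩ := hf.ode
  -- a symmetric interval `[−μ, μ] ∋ x` strictly inside `(−λ, λ)`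
  set μ : ℝ := (|x| + lam) / 2 with hμ
  have hxabs : |x| < lam := abs_lt.mpr ⟨hx.1, hx.2⟩
  have hμlam : μ < lam := by rw [hμ]; linarith
  have hμpos : 0 < μ := by rw [hμ]; linarith [abs_nonneg x]
  have hxμ : x ∈ Ioo (-μ) μ := by
    rw [hμ]; constructor <;> cases abs_lt.mp (show |x| < (|x| + lam) / 2 by linarith) <;> linarith
  have hsub : Ioo (-μ) μ ⊆ Ioo (-lam) lam := Ioo_subset_Ioo (by linarith) hμlam.le
  -- the vector field of the phase system `Y = (f, f′)`
  let v : ℝ → ℝ × ℝ → ℝ × ℝ := fun t Y ↦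
    (Y.2, (2 * t * Y.2 + ((2 * π * lam * t) ^ 2 - χ) * Y.1) / (lam ^ 2 - t ^ 2))
  set L : ℝ := (2 * lam + ((2 * π * lam * lam) ^ 2 + |χ|)) / (lam ^ 2 - μ ^ 2) + 1 with hL
  have hden : 0 < lam ^ 2 - μ ^ 2 := by nlinarith
  have hLpos : 0 < L := by rw [hL]; positivity
  have hv : ∀ t ∈ Ioo (-μ) μ, LipschitzOnWith (Real.toNNReal L) (v t) univ := by
    intro t ht
    have htabs : |t| < μ := abs_lt.mpr ⟨ht.1, ht.2⟩
    have hpt : lam ^ 2 - μ ^ 2 ≤ lam ^ 2 - t ^ 2 := by nlinarith [abs_nonneg t, sq_abs t]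
    have hpt0 : 0 < lam ^ 2 - t ^ 2 := lt_of_lt_of_le hden hpt
    refine (LipschitzWith.of_dist_le_mul fun Y Z ↦ ?_).lipschitzOnWith
    rw [Real.coe_toNNReal _ hLpos.le]
    have hd1 : dist Y.1 Z.1 ≤ dist Y Z := by rw [Prod.dist_eq]; exact le_max_left _ _
    have hd2 : dist Y.2 Z.2 ≤ dist Y Z := by rw [Prod.dist_eq]; exact le_max_right _ _
    rw [Real.dist_eq] at hd1 hd2
    have hdYZ : 0 ≤ dist Y Z := dist_nonneg
    rw [Prod.dist_eq]
    refine max_le ?_ ?_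
    · -- first component
      rw [Real.dist_eq]
      calc |Y.2 - Z.2| ≤ dist Y Z := hd2
        _ = 1 * dist Y Z := (one_mul _).symm
        _ ≤ L * dist Y Z := by
            gcongr; rw [hL]
            linarith [show 0 ≤ (2 * lam + ((2 * π * lam * lam) ^ 2 + |χ|)) / (lam ^ 2 - μ ^ 2) by
              positivity]
    · rw [Real.dist_eq, ← sub_div, abs_div, abs_of_pos hpt0]
      have hcoef1 : |2 * t| ≤ 2 * lam := by rw [abs_mul, abs_two]; linarith
      have hcoef2 : |(2 * π * lam * t) ^ 2 - χ| ≤ (2 * π * lam * lam) ^ 2 + |χ| := by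
        refine (abs_sub _ _).trans (add_le_add ?_ le_rfl)
        rw [abs_pow, pow_le_pow_iff_left₀ (abs_nonneg _) (by positivity) two_ne_zero, abs_mul,
          abs_of_pos (by positivity : 0 < 2 * π * lam)]
        exact mul_le_mul_of_nonneg_left (by linarith) (by positivity)
      have hnum : |2 * t * Y.2 + ((2 * π * lam * t) ^ 2 - χ) * Y.1
            - (2 * t * Z.2 + ((2 * π * lam * t) ^ 2 - χ) * Z.1)|
          ≤ (2 * lam + ((2 * π * lam * lam) ^ 2 + |χ|)) * dist Y Z := by
        have e : 2 * t * Y.2 + ((2 * π * lam * t) ^ 2 - χ) * Y.1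
            - (2 * t * Z.2 + ((2 * π * lam * t) ^ 2 - χ) * Z.1)
            = 2 * t * (Y.2 - Z.2) + ((2 * π * lam * t) ^ 2 - χ) * (Y.1 - Z.1) := by ring
        rw [e]
        refine (abs_add_le _ _).trans ?_
        rw [abs_mul (2 * t), abs_mul ((2 * π * lam * t) ^ 2 - χ), add_mul]
        exact add_le_add (mul_le_mul hcoef1 hd2 (abs_nonneg _) (by linarith))
          (mul_le_mul hcoef2 hd1 (abs_nonneg _) (by positivity))
      calc |2 * t * Y.2 + ((2 * π * lam * t) ^ 2 - χ) * Y.1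
              - (2 * t * Z.2 + ((2 * π * lam * t) ^ 2 - χ) * Z.1)| / (lam ^ 2 - t ^ 2)
          ≤ (2 * lam + ((2 * π * lam * lam) ^ 2 + |χ|)) * dist Y Z / (lam ^ 2 - μ ^ 2) := by
            gcongr
        _ = ((2 * lam + ((2 * π * lam * lam) ^ 2 + |χ|)) / (lam ^ 2 - μ ^ 2)) * dist Y Z := by
            ring
        _ ≤ L * dist Y Z := by gcongr; rw [hL]; linarith
  -- the two solutions
  have hYf : ∀ t ∈ Ioo (-μ) μ,
      HasDerivAt (fun s ↦ (f s, deriv f s)) (v t (f t, deriv f t)) t ∧ (f t, deriv f t) ∈ univ := by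
    intro t ht
    have ht' := hsub ht
    have hpt0 : lam ^ 2 - t ^ 2 ≠ 0 := by
      have : |t| < lam := abs_lt.mpr ⟨ht'.1, ht'.2⟩; nlinarith [abs_nonneg t, sq_abs t]
    refine ⟨?_, mem_univ _⟩
    have h := ((hf.differentiableAt ht').hasDerivAt).prodMk ((hf.differentiableAt_deriv ht').hasDerivAt)
    convert h using 2
    rw [div_eq_iff hpt0]
    linear_combination -(hode t ht')
  have hYg : ∀ t ∈ Ioo (-μ) μ,
      HasDerivAt (fun s ↦ (f (-s), -deriv f (-s))) (v t (f (-t), -deriv f (-t))) t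
        ∧ (f (-t), -deriv f (-t)) ∈ univ := by
    intro t ht
    have ht' := hsub ht
    have hnt : -t ∈ Ioo (-lam) lam := ⟨by linarith [ht'.2], by linarith [ht'.1]⟩
    have hpt0 : lam ^ 2 - t ^ 2 ≠ 0 := by
      have : |t| < lam := abs_lt.mpr ⟨ht'.1, ht'.2⟩; nlinarith [abs_nonneg t, sq_abs t]
    refine ⟨?_, mem_univ _⟩
    have h := (hf.hasDerivAt_comp_neg ht').prodMk (hf.hasDerivAt_neg_deriv_comp_neg ht')
    convert h using 2
    rw [div_eq_iff hpt0]
    have e2 := hode (-t) hnt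
    linear_combination -e2
  have h0μ : (0 : ℝ) ∈ Ioo (-μ) μ := ⟨by linarith, hμpos⟩
  have heq : (fun s ↦ (f s, deriv f s)) 0 = (fun s ↦ (f (-s), -deriv f (-s))) 0 := by
    simp [hf.deriv_zero]
  have hE := ODE_solution_unique_of_mem_Ioo hv h0μ hYf hYg heq hxμ
  have := congrArg Prod.fst hE
  simpa using this.symm

/-- **Prolate functions are even**: `h_{n,λ}(−x) = h_{n,λ}(x)` for all `x` (inside `(−λ, λ)` by the ODE
argument, at `±λ` by continuity on `[−λ, λ]`, outside by the support condition).  This is the parity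
`ψ_n(−x) = (−1)^n ψ_n(x)` of the prolate spheroidal wave functions for the (even-index) functions of the
Letter, derived here from the axioms of `IsProlateFunction` alone.
[cite: SlepianPollak1961, §III; Connes2026Letter, §6.3–6.4] -/
theorem even (hf : IsProlateFunction lam n f) : ∀ x, f (-x) = f x := by
  have hlam := hf.lam_pos
  -- the end points: `f(−λ) = f(λ)` by continuity from inside
  have hcont : ContinuousOn f (Icc (-lam) lam) := hf.contDiffOn.continuousOn
  have hend : f (-lam) = f lam := by
    haveI : (𝓝[Ioo (-lam) lam] lam).NeBot := by
      refine mem_closure_iff_nhdsWithin_neBot.mp ?_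
      rw [closure_Ioo (by linarith : (-lam) ≠ lam)]
      exact ⟨by linarith, le_rfl⟩
    have T1 : Tendsto f (𝓝[Ioo (-lam) lam] lam) (𝓝 (f lam)) :=
      (hcont.continuousWithinAt ⟨by linarith, le_rfl⟩).tendsto.mono_left
        (nhdsWithin_mono _ Ioo_subset_Icc_self)
    have T2 : Tendsto (fun t ↦ f (-t)) (𝓝[Ioo (-lam) lam] lam) (𝓝 (f (-lam))) := by
      have hc : ContinuousWithinAt f (Icc (-lam) lam) (-lam) :=
        hcont.continuousWithinAt ⟨le_rfl, by linarith⟩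
      have hneg : ContinuousWithinAt (fun t : ℝ ↦ -t) (Ioo (-lam) lam) lam :=
        continuous_neg.continuousWithinAt
      have hmaps : MapsTo (fun t : ℝ ↦ -t) (Ioo (-lam) lam) (Icc (-lam) lam) :=
        fun t ht ↦ ⟨by linarith [ht.2], by linarith [ht.1]⟩
      exact (hc.comp hneg hmaps).tendsto
    have hev : (fun t ↦ f (-t)) =ᶠ[𝓝[Ioo (-lam) lam] lam] f := by
      filter_upwards [self_mem_nhdsWithin] with t ht using hf.even_of_mem_Ioo ht
    exact tendsto_nhds_unique (T2.congr' hev) T1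
  intro x
  rcases lt_trichotomy |x| lam with h | h | h
  · exact hf.even_of_mem_Ioo (abs_lt.mp h |> fun h' ↦ ⟨h'.1, h'.2⟩)
  · rcases (abs_eq hlam.le).mp h with rfl | rfl
    · exact hend
    · rw [neg_neg]; exact hend.symm
  · rw [hf.support x h, hf.support (-x) (by rwa [abs_neg])]

end IsProlateFunction

end Literature.NumberTheory.LFunctions
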